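import Mathlib.Analysis.Fourier.ZMod
import Mathlib.Analysis.SpecialFunctions.Pow.Real
import HarnessLib

/-!
# The discrete fractal uncertainty principle for regular subsets of `ℤ_N` (Dyatlov–Jin 2018)

Topic `Literature/Analysis/Fourier`. One definition and two NAMED FACTS (`Prop`s, nothing
asserted), vendored while grounding route `QuantumAdvantage/AreaUncertainty`, crux `PorousFUP`
(item stmt-QuantumAdvantage-9607,
`Summit.QuantumAdvantage.QuantumAdvantage.Theses.AreaUncertainty.PorousFUP`: a fractal
uncertainty principle for *porous* pairs `X, T ⊂ ℤ/N`). The printed discrete statement is for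
Ahlfors–David *regular* sets; porous sets are subsets of `δ`-regular sets with `δ < 1`
(Dyatlov, *An introduction to fractal uncertainty principle*, J. Math. Phys. 60 (2019),
Prop. 2.x "regular–porous", part 2, in the continuum), so the facts below are the analytic core
of that item, not the item itself.

* `IsDiscreteRegular δ C_R N X` — S. Dyatlov, L. Jin, *Dolgopyat's method and the fractal
  uncertainty principle*, Analysis & PDE 11 (2018) 1457–1485 (arXiv:1702.03619), Definition 4.2:
  "We say that `X ⊂ ℤ_N` is `δ`-regular with constant `C_R` if • for each interval `J` of size
  `|J| ≥ 1`, we have `#(J ∩ X) ≤ C_R |J|^δ`, and • for each interval `J` with `1 ≤ |J| ≤ N`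
  which is centered at a point in `X`, we have `#(J ∩ X) ≥ C_R^{-1} |J|^δ`."
  Here `ℤ_N = {0, …, N - 1}` (§4, p. 14: "`ℤ_M = {0, 1, …, M - 1}`"), viewed inside `ℝ`, and
  `J` ranges over real intervals (Lemma 4.3 ibid. identifies the notion with continuum
  regularity of `N^{-1} X ⊂ [0, 1]` carrying counting measure).
* `DyatlovJin2018_prop_4_8` — ibid., Proposition 4.8 (the discrete fractal uncertainty
  principle): "Let `X, Y ⊂ ℤ_N` be `δ`-regular with constant `C_R` and `0 ≤ δ < 1`. Then
  `‖𝟙_X 𝓕_N 𝟙_Y‖_{ℓ²_N → ℓ²_N} ≤ C N^{-β}` where `C, β > 0` only depend on `δ, C_R`."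
* `DyatlovJin2018_prop_4_6` — ibid., Proposition 4.6 (explicit exponent for small `δ`): for
  `X, Y ⊂ ℤ_N` `δ`-regular with constant `C_R` and `0 < δ < 1`,
  `‖𝟙_X 𝓕_N 𝟙_Y‖_{ℓ²_N → ℓ²_N} ≤ C N^{-(1/2 - δ + ε₀)}`, `ε₀ = (5 C_R)^{-160/(δ(1-δ))}`, where
  `C` only depends on `δ, C_R`.

## Rendering

* `𝓕_N` is the UNITARY discrete Fourier transform, "the `N × N` matrix
  `N^{-1/2} (e^{-2πi jℓ/N})_{jℓ}`" (§4, p. 14). Mathlib's `ZMod.dft` is the unnormalised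
  transform `𝓕 Φ k = ∑_j e^{-2πi jk/N} Φ j` (`ZMod.dft_apply`, `stdAddChar j = e^{2πi j/N}`),
  with the same sign, so `𝓕 = √N · 𝓕_N`. An operator-norm bound `‖𝟙_X 𝓕_N 𝟙_Y‖ ≤ B` is
  rendered, equivalently, as: for every `u : ℤ/N → ℂ` vanishing off `Y`,
  `∑_{j ∈ X} |𝓕 u (j)|² ≤ B² · N · ∑_ℓ |u ℓ|²` (apply the bound to `𝟙_Y u`; conversely
  `‖𝟙_Y u‖ ≤ ‖u‖`).
* Sets are `Finset ℕ` whose elements are `< N` (hypothesis), read in `ℤ/N` through the cast;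
  intervals are closed real intervals `[a, a + ℓ]` of size `ℓ`, and "centered at `x`" is
  `[x - ℓ/2, x + ℓ/2]`. (Open/half-open readings change counts by `≤ 2` points and are absorbed
  in `C_R`; the constants `C, β` depend on `C_R` anyway.)
* `|J|^δ` and `N^{-β}` are real powers (`Real.rpow`).
* The porous → regular step needed by `PorousFUP` (a `ν`-porous `X ⊂ ℤ_N` on scales `1/ν` to
  `N` lies in a `δ(ν)`-regular `Y ⊂ ℤ_N`, `δ(ν) < 1`) is printed only in the continuum
  (Dyatlov 2019, regular–porous proposition, part 2); it is NOT vendored here.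
-/

namespace Literature.Analysis.Fourier

open scoped BigOperators

/-- The number of points of `X ⊂ ℕ` in the closed real interval `[a, b]`: `#([a, b] ∩ X)`.
[cite: DyatlovJin2018, Def. 4.2] -/
noncomputable def countInIcc (X : Finset ℕ) (a b : ℝ) : ℕ :=
  (X.filter fun x : ℕ => a ≤ (x : ℝ) ∧ (x : ℝ) ≤ b).card

/-- **Dyatlov–Jin 2018, Definition 4.2** (discrete Ahlfors–David regularity), verbatim: "We say
that `X ⊂ ℤ_N` is `δ`-regular with constant `C_R` if • for each interval `J` of size `|J| ≥ 1`,
we have `#(J ∩ X) ≤ C_R |J|^δ`, and • for each interval `J` with `1 ≤ |J| ≤ N` which is centered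
at a point in `X`, we have `#(J ∩ X) ≥ C_R^{-1} |J|^δ`." (`ℤ_N = {0, …, N-1} ⊂ ℝ`; intervals
are closed real intervals `[a, a + ℓ]` of size `ℓ`; membership `X ⊆ {0, …, N-1}` is imposed
where the notion is used.) [cite: DyatlovJin2018, Def. 4.2] -/
def IsDiscreteRegular (δ C_R : ℝ) (N : ℕ) (X : Finset ℕ) : Prop :=
  (∀ a ℓ : ℝ, 1 ≤ ℓ → (countInIcc X a (a + ℓ) : ℝ) ≤ C_R * ℓ ^ δ) ∧
    ∀ x ∈ X, ∀ ℓ : ℝ, 1 ≤ ℓ → ℓ ≤ N →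
      C_R⁻¹ * ℓ ^ δ ≤ (countInIcc X ((x : ℝ) - ℓ / 2) ((x : ℝ) + ℓ / 2) : ℝ)

/-- **Dyatlov–Jin 2018, Proposition 4.8** (discrete fractal uncertainty principle), verbatim:
"Let `X, Y ⊂ ℤ_N` be `δ`-regular with constant `C_R` and `0 ≤ δ < 1`. Then
`‖𝟙_X 𝓕_N 𝟙_Y‖_{ℓ²_N → ℓ²_N} ≤ C N^{-β}` where `C, β > 0` only depend on `δ, C_R`." Here
`𝓕_N = N^{-1/2}(e^{-2πi jℓ/N})_{jℓ}` is the unitary DFT (§4, p. 14); with Mathlib's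
unnormalised `ZMod.dft = √N · 𝓕_N` the bound reads: for every `u` vanishing off `Y`,
`∑_{j ∈ X} |ZMod.dft u j|² ≤ C² N^{1 - 2β} ∑_ℓ |u ℓ|²`. Printed for regular sets; the porous
sets of `Summit.QuantumAdvantage.QuantumAdvantage.Theses.AreaUncertainty.PorousFUP` are
subsets of such (Dyatlov 2019, regular–porous proposition), which this fact does not include.
[cite: DyatlovJin2018, Prop. 4.8] -/
def DyatlovJin2018_prop_4_8 : Prop :=
  ∀ δ C_R : ℝ, 0 ≤ δ → δ < 1 →
    ∃ C β : ℝ, 0 < C ∧ 0 < β ∧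
      ∀ (N : ℕ) [NeZero N] (X Y : Finset ℕ), (∀ x ∈ X, x < N) → (∀ y ∈ Y, y < N) →
        IsDiscreteRegular δ C_R N X → IsDiscreteRegular δ C_R N Y →
          ∀ u : ZMod N → ℂ, (∀ ℓ : ZMod N, ℓ.val ∉ Y → u ℓ = 0) →
            ∑ j ∈ (Finset.univ.filter fun j : ZMod N => j.val ∈ X), ‖ZMod.dft u j‖ ^ 2 ≤
              C ^ 2 * (N : ℝ) ^ (1 - 2 * β) * ∑ ℓ : ZMod N, ‖u ℓ‖ ^ 2

/-- **Dyatlov–Jin 2018, Proposition 4.6** (discrete FUP with explicit exponent), verbatim: "Let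
`X, Y ⊂ ℤ_N` be `δ`-regular with constant `C_R` and `0 < δ < 1`. Then
`‖𝟙_X 𝓕_N 𝟙_Y‖_{ℓ²_N → ℓ²_N} ≤ C N^{-(1/2 - δ + ε₀)}` where `C` only depends on `δ, C_R` and
`ε₀ = (5 C_R)^{-160/(δ(1-δ))}`." Rendered with Mathlib's unnormalised `ZMod.dft = √N · 𝓕_N`
as in `DyatlovJin2018_prop_4_8`: for `u` vanishing off `Y`,
`∑_{j ∈ X} |ZMod.dft u j|² ≤ C² N^{1 - 2(1/2 - δ + ε₀)} ∑_ℓ |u ℓ|²`. (`C_R > 0` is implicit in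
print: a nonempty regular set forces `C_R ≥ 1`.) [cite: DyatlovJin2018, Prop. 4.6] -/
def DyatlovJin2018_prop_4_6 : Prop :=
  ∀ δ C_R : ℝ, 0 < δ → δ < 1 → 0 < C_R →
    ∃ C : ℝ, 0 < C ∧
      ∀ (N : ℕ) [NeZero N] (X Y : Finset ℕ), (∀ x ∈ X, x < N) → (∀ y ∈ Y, y < N) →
        IsDiscreteRegular δ C_R N X → IsDiscreteRegular δ C_R N Y →
          ∀ u : ZMod N → ℂ, (∀ ℓ : ZMod N, ℓ.val ∉ Y → u ℓ = 0) →
            ∑ j ∈ (Finset.univ.filter fun j : ZMod N => j.val ∈ X), ‖ZMod.dft u j‖ ^ 2 ≤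
              C ^ 2 * (N : ℝ) ^ (1 - 2 * (1 / 2 - δ + (5 * C_R) ^ (-(160 / (δ * (1 - δ)))))) *
                ∑ ℓ : ZMod N, ‖u ℓ‖ ^ 2

end Literature.Analysis.Fourier
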